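import Literature.Analysis.PDE.SobolevPairing
import Mathlib.Analysis.Distribution.FourierMultiplier
import HarnessLib

/-!
# `Λ_s = (1 - Δ)^s` on Schwartz space and its inverse (Fourier multiplier)

Analytic lemma for the energy-method programme for short-time existence of quasilinear strictly
parabolic second-order systems on a closed manifold (hypothesis `hQL` of
`Literature.Geometry.Riemannian.ricciFlow_shortTime_existence_of_quasilinear`). The Kato–Lai
solution of the localised system is tested against `Λ_s ψ`, `ψ` smooth compactly supported,
`Λ_s = Σ_{w : OWord s} (-1)^{|w|} ∂_w ∂_w` the operator realising the `H^s` pairing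
(`SobolevPairing.lean`; the Kato–Lai run follows in a later file). To reach arbitrary test
functions one inverts `Λ_s` in the
Schwartz class:

* `sOp v`, `LamS s` — the word derivatives and `Λ_s` as continuous linear maps on Schwartz
  space, `⇑(sOp v f) = cwd v ⇑f`, `⇑(LamS s f) = LamFun s ⇑f`;
* `LamS_succ` — `Λ_{s+1} = Λ_s ∘ (1 - Δ)`, hence `Λ_s = (1 - Δ)^s`
  (expand `(1 - Σᵢ ∂ᵢ²)^s` over padded words);
* `LamS_eq_fourierMultiplierCLM` — on `𝓢(ℝⁿ, ℂ)`, `Λ_s` is the Fourier multiplier with symbol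
  `(1 + (2π)² ‖ξ‖²)^s` (Mathlib's `laplacian_eq_fourierMultiplierCLM` and the composition rule
  for multipliers);
* `exists_LamS_eq_complex`, `exists_LamS_eq_real`, `exists_LamS_eq` — **`Λ_s : 𝓢 → 𝓢` is onto**
  (the inverse is the multiplier with the temperate symbol `(1 + (2π)² ‖ξ‖²)^{-s}`), for complex,
  real and finite-dimensional-inner-product-space values.
[cite: TaylorPDEIII2011, Ch. 13, §1 (Bessel potentials); Evans2010, §5.8.4]

Everything is proved; no named fact and no `sorry` is introduced.

## References

* M. E. Taylor, *Partial differential equations III*, 2nd ed., Springer 2011, Ch. 13, §1.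
  [TaylorPDEIII2011]
* L. C. Evans, *Partial differential equations*, 2nd ed., AMS 2010, §5.8.4 (Fourier
  characterisation of `H^k`). [Evans2010]
-/

noncomputable section

open MeasureTheory Set Function Filter Metric SchwartzMap LineDeriv Laplacian FourierTransform
open scoped ContDiff Topology RealInnerProductSpace SchwartzMap

namespace Literature.Analysis.PDE

universe u

variable {ι : Type u} [Fintype ι] [DecidableEq ι]

/-! ### Word derivatives and `Λ_s` on Schwartz space -/

section WordOp

variable {F : Type*} [NormedAddCommGroup F] [NormedSpace ℝ F]

/-- The word derivative `∂_v` as a continuous linear map on Schwartz space. [folklore] -/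
def sOp : List ι → 𝓢(EuclideanSpace ℝ ι, F) →L[ℝ] 𝓢(EuclideanSpace ℝ ι, F)
  | [] => ContinuousLinearMap.id ℝ _
  | i :: v => (lineDerivOpCLM ℝ 𝓢(EuclideanSpace ℝ ι, F) (bv i)).comp (sOp v)

omit [DecidableEq ι] in
/-- `sOp [] = id`. [folklore] -/
@[simp]
theorem sOp_nil (f : 𝓢(EuclideanSpace ℝ ι, F)) : sOp ([] : List ι) f = f := rfl

omit [DecidableEq ι] in
/-- `sOp (i :: v) f = ∂_{e_i} (sOp v f)`. [folklore] -/
theorem sOp_cons (i : ι) (v : List ι) (f : 𝓢(EuclideanSpace ℝ ι, F)) :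
    sOp (i :: v) f = ∂_{(bv i : EuclideanSpace ℝ ι)} (sOp v f) := rfl

omit [DecidableEq ι] in
/-- **`sOp` realises `cwd`**: `⇑(sOp v f) = cwd v ⇑f`. [folklore] -/
theorem coe_sOp (v : List ι) (f : 𝓢(EuclideanSpace ℝ ι, F)) :
    ((sOp v f : 𝓢(EuclideanSpace ℝ ι, F)) : EuclideanSpace ℝ ι → F) = cwd v (f : EuclideanSpace ℝ ι → F) := by
  induction v with
  | nil => rfl
  | cons i v ih =>
    funext x
    rw [sOp_cons, lineDerivOp_apply_eq_fderiv, ih, cwd_cons]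

omit [DecidableEq ι] in
/-- `sOp (u ++ v) = sOp u ∘ sOp v`. [folklore] -/
theorem sOp_append (u v : List ι) (f : 𝓢(EuclideanSpace ℝ ι, F)) :
    sOp (u ++ v) f = sOp u (sOp v f) := by
  induction u with
  | nil => rfl
  | cons i u ih => rw [List.cons_append, sOp_cons, sOp_cons, ih]

omit [DecidableEq ι] in
/-- `sOp` only depends on the word up to permutation (Schwarz). [folklore] -/
theorem sOp_perm {u v : List ι} (h : u.Perm v) (f : 𝓢(EuclideanSpace ℝ ι, F)) : sOp u f = sOp v f := by
  ext x
  have := congrFun (cwd_perm (f.smooth ⊤) h) x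
  rw [← coe_sOp, ← coe_sOp] at this
  exact this

omit [DecidableEq ι] in
/-- `sOp` commutes with post-composition by a continuous linear map. [folklore] -/
theorem sOp_postcompCLM {G : Type*} [NormedAddCommGroup G] [NormedSpace ℝ G] (L : F →L[ℝ] G)
    (v : List ι) (f : 𝓢(EuclideanSpace ℝ ι, F)) :
    sOp v (f.postcompCLM L) = (sOp v f).postcompCLM L := by
  ext x
  have h1 : ((f.postcompCLM (𝕜 := ℝ) L : 𝓢(EuclideanSpace ℝ ι, G)) : EuclideanSpace ℝ ι → G) =
      fun y => L (f y) := by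
    funext y; exact postcompCLM_apply L f y
  have h2 := congrFun (cwd_clm_comp L (f := (f : EuclideanSpace ℝ ι → F)) (f.smooth ⊤) v) x
  rw [← h1, ← coe_sOp, ← coe_sOp] at h2
  rw [h2, postcompCLM_apply]

/-- **`Λ_s` on Schwartz space**: `LamS s = Σ_w (-1)^{|w|} sOp (w ++ w)`. [folklore] -/
def LamS (s : ℕ) : 𝓢(EuclideanSpace ℝ ι, F) →L[ℝ] 𝓢(EuclideanSpace ℝ ι, F) :=
  ∑ w : OWord ι s, ((-1 : ℝ) ^ w.red.length) • sOp (w.red ++ w.red)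

omit [DecidableEq ι] in
/-- The Laplacian on Schwartz space in the standard frame: `Δ f = Σ_i sOp [i, i] f`. [folklore] -/
theorem laplacian_eq_sum_sOp (f : 𝓢(EuclideanSpace ℝ ι, F)) :
    Δ f = ∑ i : ι, sOp [i, i] f := by
  rw [SchwartzMap.laplacian_eq_sum (EuclideanSpace.basisFun ι ℝ) f]
  rfl

omit [DecidableEq ι] in
/-- Unfolding `LamS`. [folklore] -/
theorem LamS_apply (s : ℕ) (f : 𝓢(EuclideanSpace ℝ ι, F)) :
    LamS s f = ∑ w : OWord ι s, ((-1 : ℝ) ^ w.red.length) • sOp (w.red ++ w.red) f := by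
  rw [LamS]
  simp only [FunLike.coe_sum, Finset.sum_apply]
  rfl

omit [DecidableEq ι] in
/-- **`Λ_{s+1} = Λ_s ∘ (1 - Δ)`.** [folklore] -/
theorem LamS_succ (s : ℕ) (f : 𝓢(EuclideanSpace ℝ ι, F)) : LamS (s + 1) f = LamS s (f - Δ f) := by
  rw [LamS_apply, LamS_apply, OWord.sum_succ (M := 𝓢(EuclideanSpace ℝ ι, F))
    (fun w' : OWord ι (s + 1) => ((-1 : ℝ) ^ w'.red.length) • sOp (w'.red ++ w'.red) f)]
  refine Finset.sum_congr rfl fun w _ => ?_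
  rw [Fintype.sum_option, OWord.red_snoc_none, map_sub, smul_sub, laplacian_eq_sum_sOp, map_sum,
    Finset.smul_sum, sub_eq_add_neg, ← Finset.sum_neg_distrib]
  congr 1
  refine Finset.sum_congr rfl fun i _ => ?_
  rw [OWord.red_snoc_some, List.length_append, List.length_singleton, pow_succ, mul_neg, mul_one,
    neg_smul, ← sOp_append]
  congr 2
  refine sOp_perm ?_ f
  simp only [List.append_assoc, List.cons_append, List.nil_append]
  exact (List.perm_middle.symm.append_left w.red).trans (by simp)

end WordOp

section Coe

variable {W : Type*} [NormedAddCommGroup W] [InnerProductSpace ℝ W]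

omit [DecidableEq ι] in
/-- **`LamS` realises `LamFun`**: `⇑(LamS s f) = LamFun s ⇑f`. [folklore] -/
theorem coe_LamS (s : ℕ) (f : 𝓢(EuclideanSpace ℝ ι, W)) :
    ((LamS s f : 𝓢(EuclideanSpace ℝ ι, W)) : EuclideanSpace ℝ ι → W) =
      LamFun s (f : EuclideanSpace ℝ ι → W) := by
  funext x
  rw [LamFun_apply, LamS_apply]
  simp only [sum_apply, smul_apply]
  refine Finset.sum_congr rfl fun w _ => ?_
  rw [sOp_append, coe_sOp, coe_sOp]

end Coe

/-! ### The symbol of `Λ_s` -/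

section Symbol

/-- The symbol of `1 - Δ` with Mathlib's Fourier convention: `m₁ ξ = 1 + (2π)² ‖ξ‖²`. [folklore] -/
def m₁ (ξ : EuclideanSpace ℝ ι) : ℝ := 1 + (2 * Real.pi) ^ 2 * ‖ξ‖ ^ 2

omit [DecidableEq ι] in
/-- `m₁` has temperate growth. [folklore] -/
theorem hasTemperateGrowth_m₁ : (m₁ : EuclideanSpace ℝ ι → ℝ).HasTemperateGrowth := by
  unfold m₁
  fun_prop

omit [DecidableEq ι] in
/-- `m₁ ≥ 1`. [folklore] -/
theorem one_le_m₁ (ξ : EuclideanSpace ℝ ι) : 1 ≤ m₁ ξ := by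
  unfold m₁
  have : 0 ≤ (2 * Real.pi) ^ 2 * ‖ξ‖ ^ 2 := by positivity
  linarith

omit [DecidableEq ι] in
/-- Powers of `m₁` have temperate growth. [folklore] -/
theorem hasTemperateGrowth_m₁_pow (s : ℕ) :
    (fun ξ : EuclideanSpace ℝ ι => m₁ ξ ^ s).HasTemperateGrowth :=
  hasTemperateGrowth_m₁.pow s

/-- The inverse symbol `n_s ξ = (1 + ‖2π ξ‖²)^{-s}`. [folklore] -/
def nS (s : ℕ) (ξ : EuclideanSpace ℝ ι) : ℝ := (1 + ‖(2 * Real.pi) • ξ‖ ^ 2) ^ (-(s : ℝ))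

omit [DecidableEq ι] in
/-- `n_s` has temperate growth (Mathlib's Bessel-potential lemma composed with a dilation).
[folklore] -/
theorem hasTemperateGrowth_nS (s : ℕ) : (nS s : EuclideanSpace ℝ ι → ℝ).HasTemperateGrowth := by
  have h1 := Function.hasTemperateGrowth_one_add_norm_sq_rpow (EuclideanSpace ℝ ι) (-(s : ℝ))
  have h2 : (fun ξ : EuclideanSpace ℝ ι => (2 * Real.pi) • ξ).HasTemperateGrowth :=
    ((2 * Real.pi) • ContinuousLinearMap.id ℝ (EuclideanSpace ℝ ι)).hasTemperateGrowth
  exact h1.comp h2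

omit [DecidableEq ι] in
/-- `m₁^s · n_s = 1`. [folklore] -/
theorem m₁_pow_mul_nS (s : ℕ) :
    ((fun ξ : EuclideanSpace ℝ ι => m₁ ξ ^ s) * nS s) = fun _ => 1 := by
  funext ξ
  simp only [Pi.mul_apply, nS]
  have hm : 0 < m₁ ξ := lt_of_lt_of_le one_pos (one_le_m₁ ξ)
  have he : 1 + ‖(2 * Real.pi) • ξ‖ ^ 2 = m₁ ξ := by
    rw [m₁, norm_smul, Real.norm_eq_abs, abs_of_pos (by positivity), mul_pow]
  rw [he, Real.rpow_neg hm.le, Real.rpow_natCast, mul_inv_cancel₀ (pow_ne_zero _ hm.ne')]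

omit [DecidableEq ι] in
/-- **`1 - Δ` is the Fourier multiplier with symbol `m₁`** on `𝓢(ℝⁿ, ℂ)`. [folklore] -/
theorem sub_laplacian_eq_fourierMultiplierCLM (f : 𝓢(EuclideanSpace ℝ ι, ℂ)) :
    f - Δ f = fourierMultiplierCLM ℂ (m₁ : EuclideanSpace ℝ ι → ℝ) f := by
  rw [SchwartzMap.laplacian_eq_fourierMultiplierCLM, fourierMultiplierCLM_apply,
    fourierMultiplierCLM_apply]
  have h1 : (m₁ : EuclideanSpace ℝ ι → ℝ) = (fun _ => (1 : ℝ)) +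
      fun ξ : EuclideanSpace ℝ ι => (2 * Real.pi) ^ 2 * ‖ξ‖ ^ 2 := by
    funext ξ; simp [m₁]
  have hc : (fun _ : EuclideanSpace ℝ ι => (1 : ℝ)).HasTemperateGrowth := by fun_prop
  have hn : (fun ξ : EuclideanSpace ℝ ι => ‖ξ‖ ^ 2).HasTemperateGrowth := by fun_prop
  have hn' : (fun ξ : EuclideanSpace ℝ ι => (2 * Real.pi) ^ 2 * ‖ξ‖ ^ 2).HasTemperateGrowth := by
    fun_prop
  have e2 : (fun ξ : EuclideanSpace ℝ ι => (2 * Real.pi) ^ 2 * ‖ξ‖ ^ 2) =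
      ((2 * Real.pi) ^ 2 : ℝ) • fun ξ : EuclideanSpace ℝ ι => ‖ξ‖ ^ 2 := by
    funext ξ; simp
  rw [h1, smulLeftCLM_add hc hn', _root_.add_apply, smulLeftCLM_const, e2,
    smulLeftCLM_smul hn, FourierTransform.fourierInv_add]
  simp only [_root_.smul_apply, ContinuousLinearMap.id_apply, one_smul,
    fourierInv_fourier_eq, FourierTransform.fourierInv_smul, neg_smul, sub_neg_eq_add]

omit [DecidableEq ι] in
/-- **`Λ_s` is the Fourier multiplier with symbol `(1 + (2π)²‖ξ‖²)^s`** on `𝓢(ℝⁿ, ℂ)`.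
[cite: TaylorPDEIII2011, Ch. 13, §1] -/
theorem LamS_eq_fourierMultiplierCLM (s : ℕ) (f : 𝓢(EuclideanSpace ℝ ι, ℂ)) :
    LamS s f = fourierMultiplierCLM ℂ (fun ξ : EuclideanSpace ℝ ι => m₁ ξ ^ s) f := by
  induction s generalizing f with
  | zero =>
    have hred : ∀ w : OWord ι 0, w.red = [] := fun w =>
      List.eq_nil_of_length_eq_zero (Nat.le_zero.1 w.length_red_le)
    have h1 : LamS 0 f = f := by
      rw [LamS_apply]
      have h2 : ∀ w : OWord ι 0, ((-1 : ℝ) ^ w.red.length) • sOp (w.red ++ w.red) f = f := fun w => by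
        rw [hred w]; simp
      rw [Finset.sum_congr rfl fun w _ => h2 w, Finset.sum_const, Finset.card_univ]
      have hc : Fintype.card (OWord ι 0) = 1 :=
        Fintype.card_eq_one_iff.2 ⟨List.Vector.nil, fun w => w.eq_nil⟩
      rw [hc, one_smul]
    rw [h1]
    simp only [pow_zero, fourierMultiplierCLM_const, one_smul, ContinuousLinearMap.id_apply]
  | succ s ih =>
    rw [LamS_succ, sub_laplacian_eq_fourierMultiplierCLM, ih,
      fourierMultiplierCLM_fourierMultiplierCLM_apply (hasTemperateGrowth_m₁_pow s)
        hasTemperateGrowth_m₁]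
    rfl

omit [DecidableEq ι] in
/-- **`Λ_s : 𝓢(ℝⁿ, ℂ) → 𝓢(ℝⁿ, ℂ)` is onto.** [cite: TaylorPDEIII2011, Ch. 13, §1] -/
theorem exists_LamS_eq_complex (s : ℕ) (g : 𝓢(EuclideanSpace ℝ ι, ℂ)) :
    ∃ ψ : 𝓢(EuclideanSpace ℝ ι, ℂ), LamS s ψ = g := by
  refine ⟨fourierMultiplierCLM ℂ (nS s : EuclideanSpace ℝ ι → ℝ) g, ?_⟩
  rw [LamS_eq_fourierMultiplierCLM,
    fourierMultiplierCLM_fourierMultiplierCLM_apply (hasTemperateGrowth_m₁_pow s)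
      (hasTemperateGrowth_nS s), m₁_pow_mul_nS, fourierMultiplierCLM_const]
  simp

end Symbol

/-! ### Real and vector values -/

section RealVec

omit [DecidableEq ι] in
/-- `LamS` commutes with post-composition by a continuous linear map. [folklore] -/
theorem LamS_postcompCLM {F G : Type*} [NormedAddCommGroup F] [NormedSpace ℝ F]
    [NormedAddCommGroup G] [NormedSpace ℝ G] (L : F →L[ℝ] G) (s : ℕ)
    (f : 𝓢(EuclideanSpace ℝ ι, F)) : LamS s (f.postcompCLM L) = (LamS s f).postcompCLM L := by
  rw [LamS_apply, LamS_apply, map_sum]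
  refine Finset.sum_congr rfl fun w _ => ?_
  rw [map_smul, sOp_postcompCLM]

omit [DecidableEq ι] in
/-- **`Λ_s : 𝓢(ℝⁿ, ℝ) → 𝓢(ℝⁿ, ℝ)` is onto** (complexify, invert, take real parts).
[cite: TaylorPDEIII2011, Ch. 13, §1] -/
theorem exists_LamS_eq_real (s : ℕ) (g : 𝓢(EuclideanSpace ℝ ι, ℝ)) :
    ∃ ψ : 𝓢(EuclideanSpace ℝ ι, ℝ), LamS s ψ = g := by
  obtain ⟨Ψ, hΨ⟩ := exists_LamS_eq_complex s (g.postcompCLM Complex.ofRealCLM)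
  refine ⟨Ψ.postcompCLM Complex.reCLM, ?_⟩
  rw [LamS_postcompCLM, hΨ]
  ext x
  simp

variable {W : Type*} [NormedAddCommGroup W] [InnerProductSpace ℝ W] [FiniteDimensional ℝ W]

omit [DecidableEq ι] in
/-- **`Λ_s : 𝓢(ℝⁿ, W) → 𝓢(ℝⁿ, W)` is onto** for a finite-dimensional real inner product space `W`
(componentwise in an orthonormal basis). [cite: TaylorPDEIII2011, Ch. 13, §1] -/
theorem exists_LamS_eq (s : ℕ) (g : 𝓢(EuclideanSpace ℝ ι, W)) :
    ∃ ψ : 𝓢(EuclideanSpace ℝ ι, W), LamS s ψ = g := by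
  set e := stdOrthonormalBasis ℝ W
  have h := fun j => exists_LamS_eq_real (ι := ι) s (g.postcompCLM (innerSL ℝ (e j)))
  choose ψ hψ using h
  refine ⟨∑ j, (ψ j).postcompCLM (ContinuousLinearMap.toSpanSingleton ℝ (e j)), ?_⟩
  rw [map_sum]
  simp only [LamS_postcompCLM, hψ]
  ext x
  simp only [sum_apply, postcompCLM_apply, ContinuousLinearMap.toSpanSingleton_apply,
    innerSL_apply_apply]
  exact e.sum_repr' (g x)

omit [DecidableEq ι] in
/-- **Inverting `Λ_s` on smooth compactly supported data**: every smooth compactly supported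
`g : ℝⁿ → W` is `Λ_s ψ` for a Schwartz `ψ`, as functions. [cite: TaylorPDEIII2011, Ch. 13, §1] -/
theorem exists_LamFun_eq (s : ℕ) {g : EuclideanSpace ℝ ι → W} (hg : ContDiff ℝ ∞ g)
    (hgc : HasCompactSupport g) :
    ∃ ψ : 𝓢(EuclideanSpace ℝ ι, W), LamFun s (ψ : EuclideanSpace ℝ ι → W) = g := by
  obtain ⟨ψ, hψ⟩ := exists_LamS_eq s (hgc.toSchwartzMap hg)
  refine ⟨ψ, ?_⟩
  rw [← coe_LamS, hψ]
  rfl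

end RealVec

/-! ### Decay of Schwartz words -/

section Decay

variable {F : Type*} [NormedAddCommGroup F] [NormedSpace ℝ F]

omit [DecidableEq ι] in
/-- **Schwartz decay of word derivatives**: `‖x‖^k ‖∂_v ψ(x)‖ ≤ C`. [folklore] -/
theorem exists_pow_mul_norm_cwd_le (ψ : 𝓢(EuclideanSpace ℝ ι, F)) (v : List ι) (k : ℕ) :
    ∃ C : ℝ, 0 < C ∧ ∀ x, ‖x‖ ^ k * ‖cwd v (ψ : EuclideanSpace ℝ ι → F) x‖ ≤ C := by
  obtain ⟨C, hC, h⟩ := (sOp v ψ).decay k 0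
  refine ⟨C, hC, fun x => ?_⟩
  have := h x
  rwa [norm_iteratedFDeriv_zero, coe_sOp] at this

omit [DecidableEq ι] in
/-- **An integrable majorant**: `‖∂_v ψ(x)‖ ≤ C (1 + ‖x‖)^{-k}` for every `k`. [folklore] -/
theorem exists_norm_cwd_le_mul_inv_pow (ψ : 𝓢(EuclideanSpace ℝ ι, F)) (v : List ι) (k : ℕ) :
    ∃ C : ℝ, 0 ≤ C ∧ ∀ x, ‖cwd v (ψ : EuclideanSpace ℝ ι → F) x‖ ≤ C * ((1 + ‖x‖) ^ k)⁻¹ := by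
  set C : ℝ := 2 ^ k * (Finset.Iic (k, 0)).sup (fun m => SchwartzMap.seminorm ℝ m.1 m.2) (sOp v ψ)
    with hC
  refine ⟨C, by positivity, fun x => ?_⟩
  have h := one_add_le_sup_seminorm_apply (𝕜 := ℝ) (m := (k, 0)) (k := k) (n := 0) le_rfl le_rfl
    (sOp v ψ) x
  rw [norm_iteratedFDeriv_zero, coe_sOp] at h
  have hpos : 0 < (1 + ‖x‖) ^ k := by positivity
  rw [mul_comm] at h
  calc ‖cwd v (ψ : EuclideanSpace ℝ ι → F) x‖
      = ‖cwd v (ψ : EuclideanSpace ℝ ι → F) x‖ * (1 + ‖x‖) ^ k * ((1 + ‖x‖) ^ k)⁻¹ := by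
        rw [mul_assoc, mul_inv_cancel₀ hpos.ne', mul_one]
    _ ≤ C * ((1 + ‖x‖) ^ k)⁻¹ := mul_le_mul_of_nonneg_right h (by positivity)

end Decay



end Literature.Analysis.PDE

end
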